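import Summits.AtomisticToContinuum.Crystallization.Theorems.FrustratedLawDichotomyPeriodicBlockKernel

/-!
# FrustratedLawDichotomy · crux `AperiodicFrustratedLawGap` (stmt-AtomisticToContinuum-27623) — PERIODIC-BLOCK NEGATIVE KERNEL, part C:
# counting and the violation — a periodic cell whose interior classes are all `η₁`-good and `η₀`-bad with mean priced site energy below the
# interior level refutes the pair-level law for EVERY credit vector with that interior level
# (decomp-a2c, prover hand 2, structural share, generation 15; critic rows 543 (B3) / 544 (C) / 548)

* §1 `PairLevelLaw W A c₀ c₁ c₂ η₀ η₁` := `∀` finite injective `7/10`-separated `y`, `c₀·N + c₁·#good(η₀) + c₂·#good(η₁) ≤ U_W(y) − A·N` — the common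
  shape of `…SchurCut.SchurRangeGap / SchurTopologicalPricing / SchurElasticPricing` (`pairLevelLaw_iff_*`);
* §2 counting: interior translations number `≥ (n − 2k₀)³` (`card_interior_ge`), the interior/boundary splitting of block sums;
* §3 ★★ `not_pairLevelLaw_of_cell` — THE NEGATIVE KERNEL: cell data `(x, a, b, cB, diam, k₀, μ, σ, cidx)` as in part B, `W` vanishing from
  `R ≤ ϱ` on and `≤ Wsup` on `[7/10, ∞)`, every class centre `(η₁, D)`-capped-good and not `(η₀, D)`-maybe-good in the supercell motif
  (`13/10·D + 1 ≤ ϱ`, `η₀ ≤ 3/10`), and the DEFICIT `Σ_m [(Σ_q W(|x_m − superMotif q|) − W 0)/2 − A] ≤ N₀·(L₀ − δ)`, `δ > 0`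
  ⟹ `¬ PairLevelLaw W A c₀ c₁ c₂ η₀ η₁` whenever `c₀ + c₂ = L₀` (blocks with `n > 48 k₀ β⁺/δ`: deficit `δ n³/8` beats boundary relief `6 k₀ β⁺ n²`);
* §4 ★ `not_schurElasticPricing_of_cell` — E′♭(κ_E; C_E, D_E) dies for ALL `C_E, D_E` on an all-strained cell (interior level `eUp + κ_E`), and the
  T′♭ / FRG♭ twins (interior levels `eUp`, `e₁`).

Certificate obligations (hand-1 / census, per witness cell): `PerSep` (lattice argument), the dual basis, `DiamLE`, the enumeration `(μ, σ)` of
`Fin N₀ × [−k₀, k₀]³` with `cidx`, the two motif flags per class (interval fit for goodness; a rotation-invariant obstruction for badness), and ONE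
rational inequality for the deficit.  All `[folklore]`; 0 sorry.
-/

noncomputable section

namespace Summit.AtomisticToContinuum.Crystallization.Theorems.FrustratedLawDichotomyPeriodicBlockViolation

open scoped BigOperators Classical
open Metric
open Literature.MathematicalPhysics.StatisticalMechanics (interactionEnergy lennardJones)
open Summit.AtomisticToContinuum.Crystallization.Theorems.ChargedEnergyGapNegative (E3)
open Summit.AtomisticToContinuum.Crystallization.Theorems.FrustratedLawDichotomyRangeCut
open Summit.AtomisticToContinuum.Crystallization.Theorems.FrustratedLawDichotomyMotifLemmas (GoodAtScale)
open Summit.AtomisticToContinuum.Crystallization.Theorems.FrustratedLawDichotomyMotifDoorE (MaybeGoodAt)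
open Summit.AtomisticToContinuum.Crystallization.Theorems.FrustratedLawDichotomySchurCut
open Summit.AtomisticToContinuum.Crystallization.Theorems.FrustratedLawDichotomyPeriodicBlockGeometry
open Summit.AtomisticToContinuum.Crystallization.Theorems.FrustratedLawDichotomyPeriodicBlockKernel

/-! ## §1. The common shape of the Schur-cut residuals -/

/-- **`PairLevelLaw W A c₀ c₁ c₂ η₀ η₁`**: over finite injective `7/10`-separated clusters, `c₀·N + c₁·#good(η₀) + c₂·#good(η₁) ≤ U_W − A·N`. -/
def PairLevelLaw (W : ℝ → ℝ) (A c₀ c₁ c₂ η₀ η₁ : ℝ) : Prop :=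
  ∀ (N : ℕ) (y : Fin N → E3), Function.Injective y → Sep y →
    c₀ * N + c₁ * goodCount η₀ y + c₂ * goodCount η₁ y ≤ interactionEnergy W y - A * N

/-- `E′♭` is a pair-level law with `c = (eUp − D_E, −(κ_E + C_E), κ_E + D_E)` (interior level `c₀ + c₂ = eUp + κ_E`). [folklore] -/
theorem pairLevelLaw_of_schurElasticPricing {η₀ η₁ : ℝ} {w ω : ℝ → ℝ} {A eUp κE CE DE : ℝ}
    (h : SchurElasticPricing η₀ η₁ w ω A eUp κE CE DE) :
    PairLevelLaw (effPot w ω A) A (eUp - DE) (-(κE + CE)) (κE + DE) η₀ η₁ := by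
  intro N y hy hsep
  have := h N y hy hsep
  linarith

/-- `T′♭` is a pair-level law with `c = (eUp + κ_T, −C_T, −κ_T)` (interior level `eUp`). [folklore] -/
theorem pairLevelLaw_of_schurTopologicalPricing {η₀ η₁ : ℝ} {w ω : ℝ → ℝ} {A eUp κT CT : ℝ}
    (h : SchurTopologicalPricing η₀ η₁ w ω A eUp κT CT) :
    PairLevelLaw (effPot w ω A) A (eUp + κT) (-CT) (-κT) η₀ η₁ := by
  intro N y hy hsep
  have := h N y hy hsep
  linarith

/-- `FRG♭` is a pair-level law with `c = (e₁, −C, 0)` (any second tolerance). [folklore] -/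
theorem pairLevelLaw_of_schurRangeGap {w ω : ℝ → ℝ} {A e₁ C : ℝ} (η₁ : ℝ) (h : SchurRangeGap w ω A e₁ C) :
    PairLevelLaw (effPot w ω A) A e₁ (-C) 0 (1 / 20) η₁ := by
  intro N y hy hsep
  have := h N y hy hsep
  linarith

/-! ## §2. Counting interior and boundary sites of a block -/

/-- The interior translations. -/
def interiorSet (k₀ n : ℕ) : Finset (Fin 3 → Fin n) := Finset.univ.filter (Interior k₀ n)

/-- **There are at least `(n − 2k₀)³` interior translations** (`2k₀ ≤ n`). [folklore] -/
theorem card_interior_ge {k₀ n : ℕ} (hn : 2 * k₀ ≤ n) : (n - 2 * k₀) ^ 3 ≤ (interiorSet k₀ n).card := by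
  -- the injection `u ↦ u + k₀` from `{0,…,n−2k₀−1}³`
  let ι : (Fin 3 → Fin (n - 2 * k₀)) → (Fin 3 → Fin n) := fun u k => ⟨(u k : ℕ) + k₀, by have := (u k).2; omega⟩
  have hinj : Function.Injective ι := by
    intro u u' h
    funext k
    have := congrArg (fun f => ((f k : Fin n) : ℕ)) h
    simp only [ι] at this
    exact Fin.ext (by omega)
  have himg : (Finset.univ.image ι) ⊆ interiorSet k₀ n := by
    intro t ht
    obtain ⟨u, -, rfl⟩ := Finset.mem_image.1 ht
    rw [interiorSet, Finset.mem_filter]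
    refine ⟨Finset.mem_univ _, fun k => ⟨by simp [ι], ?_⟩⟩
    have := (u k).2
    simp only [ι]
    omega
  calc (n - 2 * k₀) ^ 3 = (Finset.univ : Finset (Fin 3 → Fin (n - 2 * k₀))).card := by
        rw [Finset.card_univ, Fintype.card_fun, Fintype.card_fin, Fintype.card_fin]
    _ = (Finset.univ.image ι).card := (Finset.card_image_of_injective _ hinj).symm
    _ ≤ (interiorSet k₀ n).card := Finset.card_le_card himg

/-- The interior block sites are `classes × interior translations`. [folklore] -/
theorem filter_interior_eq (N₀ k₀ n : ℕ) :
    (Finset.univ : Finset (Fin N₀ × (Fin 3 → Fin n))).filter (fun p => Interior k₀ n p.2) = Finset.univ ×ˢ interiorSet k₀ n := by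
  ext p
  simp [interiorSet]

/-- The boundary block sites are `classes × non-interior translations`. [folklore] -/
theorem filter_not_interior_eq (N₀ k₀ n : ℕ) :
    (Finset.univ : Finset (Fin N₀ × (Fin 3 → Fin n))).filter (fun p => ¬ Interior k₀ n p.2) =
      Finset.univ ×ˢ (Finset.univ.filter fun t => ¬ Interior k₀ n t) := by
  ext p
  simp

/-- **Interior sums of a class function**: `Σ_{interior p} f(p.1) = #interior · Σ_m f m`. [folklore] -/
theorem sum_interior_class {N₀ k₀ n : ℕ} (f : Fin N₀ → ℝ) :
    ∑ p ∈ (Finset.univ : Finset (Fin N₀ × (Fin 3 → Fin n))).filter (fun p => Interior k₀ n p.2), f p.1 =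
      (interiorSet k₀ n).card * ∑ m, f m := by
  rw [filter_interior_eq, Finset.sum_product, Finset.mul_sum]
  refine Finset.sum_congr rfl fun m _ => ?_
  have h : ∀ t ∈ interiorSet k₀ n, f (m, t).1 = f m := fun _ _ => rfl
  rw [Finset.sum_congr rfl h, Finset.sum_const, nsmul_eq_mul]

/-- **Number of boundary sites**: `N₀ · (n³ − #interior)`. [folklore] -/
theorem card_boundary (N₀ k₀ n : ℕ) :
    (((Finset.univ : Finset (Fin N₀ × (Fin 3 → Fin n))).filter (fun p => ¬ Interior k₀ n p.2)).card : ℝ) =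
      N₀ * ((n : ℝ) ^ 3 - (interiorSet k₀ n).card) := by
  rw [filter_not_interior_eq, Finset.card_product, Finset.card_univ, Fintype.card_fin, Nat.cast_mul]
  congr 1
  have h := Finset.card_filter_add_card_filter_not (s := (Finset.univ : Finset (Fin 3 → Fin n))) (Interior k₀ n)
  rw [Finset.card_univ, Fintype.card_fun, Fintype.card_fin, Fintype.card_fin] at h
  have h' : ((Finset.univ.filter fun t => ¬ Interior k₀ n t).card : ℝ) = (n : ℝ) ^ 3 - (interiorSet k₀ n).card := by
    rw [interiorSet]
    have := congrArg (fun z : ℕ => (z : ℝ)) h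
    simp only [Nat.cast_add, Nat.cast_pow] at this
    linarith
  exact h'

/-- **The block arithmetic**: for `δ > 0`, `β ≥ 0`, `n ≥ 4k₀`, `48 k₀ β < δ n`: `β·(n³ − (n − 2k₀)³) < δ·(n − 2k₀)³`. [folklore] -/
theorem block_arith {δ β : ℝ} {k₀ n : ℕ} (hδ : 0 < δ) (hβ : 0 ≤ β) (hn : 4 * k₀ ≤ n) (hn1 : 1 ≤ n)
    (hbig : 48 * (k₀ : ℝ) * β < δ * n) :
    β * ((n : ℝ) ^ 3 - ((n : ℝ) - 2 * k₀) ^ 3) < δ * ((n : ℝ) - 2 * k₀) ^ 3 := by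
  have hk : (0 : ℝ) ≤ k₀ := Nat.cast_nonneg k₀
  have hn' : 4 * (k₀ : ℝ) ≤ n := by exact_mod_cast hn
  have hn1' : (1 : ℝ) ≤ n := by exact_mod_cast hn1
  set u : ℝ := (n : ℝ) - 2 * k₀ with hu
  have hu2 : (n : ℝ) / 2 ≤ u := by rw [hu]; linarith
  have hu0 : 0 < u := by linarith
  have hun : u ≤ n := by rw [hu]; linarith
  -- `n³ − u³ = 2k₀ (n² + n u + u²) ≤ 6 k₀ n²`
  have hdiff : (n : ℝ) ^ 3 - u ^ 3 ≤ 6 * k₀ * (n : ℝ) ^ 2 := by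
    have h1 : (n : ℝ) ^ 3 - u ^ 3 = 2 * k₀ * ((n : ℝ) ^ 2 + n * u + u ^ 2) := by rw [hu]; ring
    rw [h1]
    have h2 : (n : ℝ) ^ 2 + n * u + u ^ 2 ≤ 3 * (n : ℝ) ^ 2 := by nlinarith
    nlinarith
  -- `u³ ≥ n³/8`
  have hu3 : (n : ℝ) ^ 3 / 8 ≤ u ^ 3 := by
    have : ((n : ℝ) / 2) ^ 3 ≤ u ^ 3 := pow_le_pow_left₀ (by positivity) hu2 3
    nlinarith
  have hn2 : (0 : ℝ) < (n : ℝ) ^ 2 := by positivity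
  calc β * ((n : ℝ) ^ 3 - u ^ 3) ≤ β * (6 * k₀ * (n : ℝ) ^ 2) := mul_le_mul_of_nonneg_left hdiff hβ
    _ = (48 * (k₀ : ℝ) * β) * (n : ℝ) ^ 2 / 8 := by ring
    _ < (δ * n) * (n : ℝ) ^ 2 / 8 := by
        have := mul_lt_mul_of_pos_right hbig hn2
        linarith
    _ = δ * ((n : ℝ) ^ 3 / 8) := by ring
    _ ≤ δ * u ^ 3 := mul_le_mul_of_nonneg_left hu3 hδ.le

/-! ## §3. The negative kernel -/

/-- ★★ **THE PERIODIC-BLOCK NEGATIVE KERNEL.**  Cell data as in part B; `W` vanishing from `R` on (`0 ≤ R ≤ ϱ`) and `≤ Wsup` on `[7/10, ∞)`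
(`Wsup ≥ 0`); every class centre `(η₁, D)`-capped-good and not `(η₀, D)`-maybe-good in the supercell motif (`13/10·D + 1 ≤ ϱ`, `η₀ ≤ 3/10`);
the deficit `Σ_m [(Σ_q W(|x_m − superMotif q|) − W 0)/2 − A] ≤ N₀·(L₀ − δ)` with `δ > 0`, `N₀ ≥ 1`.  Then NO pair-level law with interior level
`c₀ + c₂ = L₀` holds: its `n`-blocks with `n > 48 k₀ β⁺/δ` violate it (`β` = boundary relief per site). [folklore] -/
theorem not_pairLevelLaw_of_cell {N₀ M k₀ : ℕ} {x : Fin N₀ → E3} {a b : Fin 3 → E3} {cB ϱ diam : ℝ} (hN₀ : 1 ≤ N₀)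
    (hsep : PerSep x a) (hdual : ∀ j k, inner ℝ (b j) (a k) = if j = k then (1 : ℝ) else 0) (hb : ∀ j, ‖b j‖ ≤ cB)
    (hdiam : DiamLE x diam) (hk₀ : cB * (ϱ + diam) < k₀ + 1)
    {μ : Fin M → Fin N₀} {σ : Fin M → Fin 3 → ℤ} (hμσ : Function.Injective fun q => (μ q, σ q)) (hσ : ∀ q k, |σ q k| ≤ k₀)
    (hsup : ∀ (m : Fin N₀) (s : Fin 3 → ℤ), (∀ k, |s k| ≤ k₀) → ∃ q, μ q = m ∧ σ q = s)
    {cidx : Fin N₀ → Fin M} (hc : ∀ m, μ (cidx m) = m ∧ σ (cidx m) = 0)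
    {W : ℝ → ℝ} {R Wsup : ℝ} (hR0 : 0 ≤ R) (hW : ∀ r, R ≤ r → W r = 0) (hRϱ : R ≤ ϱ)
    (hWle : ∀ r, (7 : ℝ) / 10 ≤ r → W r ≤ Wsup) (hWsup : 0 ≤ Wsup)
    {η₀ η₁ D : ℝ} (hD : 13 / 10 * D + 1 ≤ ϱ) (hη₀ : η₀ ≤ 3 / 10)
    (hgood : ∀ m, GoodAtScale η₁ D (superMotif x a μ σ) (cidx m)) (hbad : ∀ m, ¬ MaybeGoodAt η₀ D (superMotif x a μ σ) (cidx m))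
    {A L₀ δ : ℝ} (hδ : 0 < δ)
    (hdef : ∑ m, (((∑ q, W (dist (x m) (superMotif x a μ σ q))) - W 0) / 2 - A) ≤ N₀ * (L₀ - δ))
    {c₀ c₁ c₂ : ℝ} (hL : c₀ + c₂ = L₀) : ¬ PairLevelLaw W A c₀ c₁ c₂ η₀ η₁ := by
  intro hlaw
  -- boundary relief per site and the block size
  set β : ℝ := max (((20 * R / 7 + 1) ^ 3 * Wsup) / 2 - A - c₀ - min c₁ 0 - min c₂ 0) 0 with hβ
  have hβ0 : 0 ≤ β := le_max_right _ _
  have hβle : ((20 * R / 7 + 1) ^ 3 * Wsup) / 2 - A - c₀ - min c₁ 0 - min c₂ 0 ≤ β := le_max_left _ _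
  obtain ⟨n, hn4, hn1, hbig⟩ : ∃ n : ℕ, 4 * k₀ ≤ n ∧ 1 ≤ n ∧ 48 * (k₀ : ℝ) * β < δ * n := by
    obtain ⟨n₁, hn₁⟩ := exists_nat_gt (48 * (k₀ : ℝ) * β / δ)
    refine ⟨max (4 * k₀ + 1) n₁, by omega, by omega, ?_⟩
    have h1 : (n₁ : ℝ) ≤ ((max (4 * k₀ + 1) n₁ : ℕ) : ℝ) := by exact_mod_cast le_max_right _ _
    rw [div_lt_iff₀ hδ] at hn₁
    nlinarith
  -- re-index the `n`-block by `Fin N`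
  suffices key : ∀ (N : ℕ) (e : (Fin N₀ × (Fin 3 → Fin n)) ≃ Fin N), False from key _ (Fintype.equivFin _)
  intro N e
  have hNcard : Fintype.card (Fin N₀ × (Fin 3 → Fin n)) = N := card_reindex e
  have hNval : (N : ℝ) = N₀ * (n : ℝ) ^ 3 := by
    rw [← hNcard, Fintype.card_prod, Fintype.card_fin, Fintype.card_fun, Fintype.card_fin, Fintype.card_fin]
    push_cast
    ring
  have hYsep := block_sep hsep n
  have hYinj := block_injective hsep n
  have hmain := hlaw N (block x a n ∘ e.symm) (injective_reindex e hYinj) (sep_reindex e hYsep)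
  have h2U := interactionEnergy_reindex e (block x a n) W
  have hg₀ := goodCount_reindex e (block x a n) η₀
  have hg₁ := goodCount_reindex e (block x a n) η₁
  -- abbreviations: the flags, the site sums, the class deficits
  set ind₀ : Fin N₀ × (Fin 3 → Fin n) → ℝ := fun p => if GoodAt η₀ (block x a n ∘ e.symm) (e p) then (1 : ℝ) else 0 with hind₀
  set ind₁ : Fin N₀ × (Fin 3 → Fin n) → ℝ := fun p => if GoodAt η₁ (block x a n ∘ e.symm) (e p) then (1 : ℝ) else 0 with hind₁
  set S : Fin N₀ × (Fin 3 → Fin n) → ℝ := fun p => ∑ q, W (dist (block x a n p) (block x a n q)) with hSdef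
  set r : Fin N₀ → ℝ := fun m => ((∑ q, W (dist (x m) (superMotif x a μ σ q))) - W 0) / 2 - A with hr
  -- the doubled per-site excess has non-negative total (this is the law on the block)
  set X : Fin N₀ × (Fin 3 → Fin n) → ℝ := fun p => S p - W 0 - 2 * A - 2 * c₀ - 2 * c₁ * ind₀ p - 2 * c₂ * ind₁ p with hX
  have hXsum : ∑ p, X p = (∑ p, S p) - N * W 0 - N * (2 * A) - N * (2 * c₀) - 2 * c₁ * (∑ p, ind₀ p) - 2 * c₂ * (∑ p, ind₁ p) := by
    simp only [hX, Finset.sum_sub_distrib, Finset.sum_const, Finset.card_univ, hNcard, nsmul_eq_mul, ← Finset.mul_sum]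
  have hsumX : 0 ≤ ∑ p, X p := by
    rw [hXsum]
    rw [hg₀, hg₁] at hmain
    linarith only [hmain, h2U]
  -- interior sites: exact site sum, flags `(bad, good)`
  have hint : ∀ p : Fin N₀ × (Fin 3 → Fin n), Interior k₀ n p.2 → X p = 2 * (r p.1 - L₀) := by
    rintro ⟨m, t⟩ ht
    have hS : S (m, t) = ∑ q, W (dist (x m) (superMotif x a μ σ q)) := by
      simp only [hSdef]
      exact siteSum_block_eq (n := n) hsep hdual hb hdiam hk₀ hμσ hσ hsup hW hRϱ ht m
    have hG : GoodAt η₁ (block x a n ∘ e.symm) (e (m, t)) :=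
      goodAt_block_of_superMotif hdual hb hdiam hk₀ hσ hsup hc hD e ht (hgood m)
    have hB : ¬ GoodAt η₀ (block x a n ∘ e.symm) (e (m, t)) :=
      not_goodAt_block_of_superMotif hsep hdual hb hdiam hk₀ hμσ hσ hsup hc hD hη₀ e ht (hbad m)
    have h0 : ind₀ (m, t) = 0 := by simp only [hind₀]; exact if_neg hB
    have h1 : ind₁ (m, t) = 1 := by simp only [hind₁]; exact if_pos hG
    simp only [hX, hr, h0, h1, hS]
    rw [← hL]
    ring
  -- boundary sites: `X p ≤ 2β`
  have hbdry : ∀ p : Fin N₀ × (Fin 3 → Fin n), X p ≤ 2 * β := by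
    intro p
    have hS : S p ≤ W 0 + (20 * R / 7 + 1) ^ 3 * Wsup := by
      simp only [hSdef]
      exact siteSum_le_of_sep hYinj hYsep hR0 hW hWle hWsup p
    have h₀ : min c₁ 0 ≤ c₁ * ind₀ p := by
      by_cases hq : GoodAt η₀ (block x a n ∘ e.symm) (e p)
      · have : ind₀ p = 1 := by simp only [hind₀]; exact if_pos hq
        rw [this, mul_one]; exact min_le_left _ _
      · have : ind₀ p = 0 := by simp only [hind₀]; exact if_neg hq
        rw [this, mul_zero]; exact min_le_right _ _
    have h₁ : min c₂ 0 ≤ c₂ * ind₁ p := by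
      by_cases hq : GoodAt η₁ (block x a n ∘ e.symm) (e p)
      · have : ind₁ p = 1 := by simp only [hind₁]; exact if_pos hq
        rw [this, mul_one]; exact min_le_left _ _
      · have : ind₁ p = 0 := by simp only [hind₁]; exact if_neg hq
        rw [this, mul_zero]; exact min_le_right _ _
    have hXp : X p = S p - W 0 - 2 * A - 2 * c₀ - 2 * c₁ * ind₀ p - 2 * c₂ * ind₁ p := rfl
    rw [hXp]
    linarith only [hS, h₀, h₁, hβle]
  -- split the total into interior and boundary
  have hsplit := (Finset.sum_filter_add_sum_filter_not (Finset.univ : Finset (Fin N₀ × (Fin 3 → Fin n)))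
    (fun p => Interior k₀ n p.2) X).symm
  have hI : ∑ p ∈ Finset.univ.filter (fun p : Fin N₀ × (Fin 3 → Fin n) => Interior k₀ n p.2), X p =
      (interiorSet k₀ n).card * ∑ m, 2 * (r m - L₀) := by
    rw [← sum_interior_class]
    exact Finset.sum_congr rfl fun p hp => hint p (Finset.mem_filter.1 hp).2
  have hB : ∑ p ∈ Finset.univ.filter (fun p : Fin N₀ × (Fin 3 → Fin n) => ¬ Interior k₀ n p.2), X p ≤
      N₀ * ((n : ℝ) ^ 3 - (interiorSet k₀ n).card) * (2 * β) := by
    rw [← card_boundary N₀ k₀ n]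
    have := Finset.sum_le_card_nsmul (Finset.univ.filter (fun p : Fin N₀ × (Fin 3 → Fin n) => ¬ Interior k₀ n p.2)) X (2 * β)
      fun p _ => hbdry p
    rwa [nsmul_eq_mul] at this
  -- the class deficit
  have hdef' : ∑ m, 2 * (r m - L₀) ≤ -(2 * N₀ * δ) := by
    have h1 : ∑ m, 2 * (r m - L₀) = 2 * (∑ m, r m) - 2 * N₀ * L₀ := by
      rw [← Finset.mul_sum, Finset.sum_sub_distrib, Finset.sum_const, Finset.card_univ, Fintype.card_fin, nsmul_eq_mul]
      ring
    rw [h1]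
    have h2 : ∑ m, r m ≤ N₀ * (L₀ - δ) := by simp only [hr]; exact hdef
    linarith only [h2]
  -- interior count bounds
  have hcardI : ((n : ℝ) - 2 * k₀) ^ 3 ≤ (interiorSet k₀ n).card := by
    have h := card_interior_ge (k₀ := k₀) (n := n) (by omega)
    have h' : (((n - 2 * k₀) ^ 3 : ℕ) : ℝ) ≤ (interiorSet k₀ n).card := by exact_mod_cast h
    have hsub : ((n - 2 * k₀ : ℕ) : ℝ) = (n : ℝ) - 2 * k₀ := by
      rw [Nat.cast_sub (by omega)]
      push_cast
      ring
    rw [Nat.cast_pow, hsub] at h'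
    exact h'
  have harith := block_arith hδ hβ0 hn4 hn1 hbig
  have hN₀' : (1 : ℝ) ≤ N₀ := by exact_mod_cast hN₀
  -- `#I · T ≤ u³ · T` for the non-positive class deficit `T`
  have hT0 : ∑ m, 2 * (r m - L₀) ≤ 0 := by
    have : (0 : ℝ) ≤ 2 * N₀ * δ := by positivity
    linarith only [hdef', this]
  have hIle : ((interiorSet k₀ n).card : ℝ) * ∑ m, 2 * (r m - L₀) ≤ ((n : ℝ) - 2 * k₀) ^ 3 * (-(2 * N₀ * δ)) := by
    have h1 : ((interiorSet k₀ n).card : ℝ) * ∑ m, 2 * (r m - L₀) ≤ ((n : ℝ) - 2 * k₀) ^ 3 * ∑ m, 2 * (r m - L₀) :=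
      mul_le_mul_of_nonpos_right hcardI hT0
    have h2 : ((n : ℝ) - 2 * k₀) ^ 3 * ∑ m, 2 * (r m - L₀) ≤ ((n : ℝ) - 2 * k₀) ^ 3 * (-(2 * N₀ * δ)) := by
      have hu : (0 : ℝ) ≤ ((n : ℝ) - 2 * k₀) ^ 3 := by
        have : (0 : ℝ) ≤ (n : ℝ) - 2 * k₀ := by
          have : 4 * (k₀ : ℝ) ≤ n := by exact_mod_cast hn4
          linarith
        positivity
      exact mul_le_mul_of_nonneg_left hdef' hu
    exact h1.trans h2
  have hBle : (N₀ : ℝ) * ((n : ℝ) ^ 3 - (interiorSet k₀ n).card) * (2 * β) ≤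
      N₀ * ((n : ℝ) ^ 3 - ((n : ℝ) - 2 * k₀) ^ 3) * (2 * β) := by
    have h1 : (n : ℝ) ^ 3 - (interiorSet k₀ n).card ≤ (n : ℝ) ^ 3 - ((n : ℝ) - 2 * k₀) ^ 3 := by linarith only [hcardI]
    have hN₀0 : (0 : ℝ) ≤ N₀ := by linarith only [hN₀']
    have h2β : (0 : ℝ) ≤ 2 * β := by linarith only [hβ0]
    have := mul_le_mul_of_nonneg_left h1 hN₀0
    exact mul_le_mul_of_nonneg_right this h2β
  -- `2 N₀ (β (n³ − u³) − δ u³) < 0`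
  have hneg : ((n : ℝ) - 2 * k₀) ^ 3 * (-(2 * N₀ * δ)) + N₀ * ((n : ℝ) ^ 3 - ((n : ℝ) - 2 * k₀) ^ 3) * (2 * β) < 0 := by
    have : ((n : ℝ) - 2 * k₀) ^ 3 * (-(2 * N₀ * δ)) + N₀ * ((n : ℝ) ^ 3 - ((n : ℝ) - 2 * k₀) ^ 3) * (2 * β) =
        2 * N₀ * (β * ((n : ℝ) ^ 3 - ((n : ℝ) - 2 * k₀) ^ 3) - δ * ((n : ℝ) - 2 * k₀) ^ 3) := by ring
    rw [this]
    have h2N : (0 : ℝ) < 2 * N₀ := by linarith only [hN₀']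
    have hin : β * ((n : ℝ) ^ 3 - ((n : ℝ) - 2 * k₀) ^ 3) - δ * ((n : ℝ) - 2 * k₀) ^ 3 < 0 := by linarith only [harith]
    exact mul_neg_of_pos_of_neg h2N hin
  rw [hsplit, hI] at hsumX
  linarith only [hsumX, hB, hIle, hBle, hneg]

/-! ## §4. The three Schur-cut residuals die on a certified all-strained cell -/

/-- ★ **E′♭ DIES FOR EVERY `C_E, D_E`** on a cell whose interior classes are all `η₁`-good and `η₀`-bad (`η₀ ≤ 3/10`) with mean priced `W`-site
energy below `eUp + κ_E` by `δ`: `¬ SchurElasticPricing η₀ η₁ w ω A eUp κ_E C_E D_E`. [folklore] -/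
theorem not_schurElasticPricing_of_cell {N₀ M k₀ : ℕ} {x : Fin N₀ → E3} {a b : Fin 3 → E3} {cB ϱ diam : ℝ} (hN₀ : 1 ≤ N₀)
    (hsep : PerSep x a) (hdual : ∀ j k, inner ℝ (b j) (a k) = if j = k then (1 : ℝ) else 0) (hb : ∀ j, ‖b j‖ ≤ cB)
    (hdiam : DiamLE x diam) (hk₀ : cB * (ϱ + diam) < k₀ + 1)
    {μ : Fin M → Fin N₀} {σ : Fin M → Fin 3 → ℤ} (hμσ : Function.Injective fun q => (μ q, σ q)) (hσ : ∀ q k, |σ q k| ≤ k₀)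
    (hsup : ∀ (m : Fin N₀) (s : Fin 3 → ℤ), (∀ k, |s k| ≤ k₀) → ∃ q, μ q = m ∧ σ q = s)
    {cidx : Fin N₀ → Fin M} (hc : ∀ m, μ (cidx m) = m ∧ σ (cidx m) = 0)
    {w ω : ℝ → ℝ} {A R Wsup : ℝ} (hR0 : 0 ≤ R) (hW : ∀ r, R ≤ r → effPot w ω A r = 0) (hRϱ : R ≤ ϱ)
    (hWle : ∀ r, (7 : ℝ) / 10 ≤ r → effPot w ω A r ≤ Wsup) (hWsup : 0 ≤ Wsup)
    {η₀ η₁ D : ℝ} (hD : 13 / 10 * D + 1 ≤ ϱ) (hη₀ : η₀ ≤ 3 / 10)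
    (hgood : ∀ m, GoodAtScale η₁ D (superMotif x a μ σ) (cidx m)) (hbad : ∀ m, ¬ MaybeGoodAt η₀ D (superMotif x a μ σ) (cidx m))
    {eUp κE δ : ℝ} (hδ : 0 < δ)
    (hdef : ∑ m, (((∑ q, effPot w ω A (dist (x m) (superMotif x a μ σ q))) - effPot w ω A 0) / 2 - A) ≤ N₀ * (eUp + κE - δ))
    (CE DE : ℝ) : ¬ SchurElasticPricing η₀ η₁ w ω A eUp κE CE DE := fun h =>
  not_pairLevelLaw_of_cell hN₀ hsep hdual hb hdiam hk₀ hμσ hσ hsup hc hR0 hW hRϱ hWle hWsup hD hη₀ hgood hbad hδ hdef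
    (c₁ := -(κE + CE)) (by ring) (pairLevelLaw_of_schurElasticPricing h)

/-- **T′♭ dies** on such a cell when the mean priced site energy is below `eUp` by `δ` (for every `C_T`). [folklore] -/
theorem not_schurTopologicalPricing_of_cell {N₀ M k₀ : ℕ} {x : Fin N₀ → E3} {a b : Fin 3 → E3} {cB ϱ diam : ℝ} (hN₀ : 1 ≤ N₀)
    (hsep : PerSep x a) (hdual : ∀ j k, inner ℝ (b j) (a k) = if j = k then (1 : ℝ) else 0) (hb : ∀ j, ‖b j‖ ≤ cB)
    (hdiam : DiamLE x diam) (hk₀ : cB * (ϱ + diam) < k₀ + 1)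
    {μ : Fin M → Fin N₀} {σ : Fin M → Fin 3 → ℤ} (hμσ : Function.Injective fun q => (μ q, σ q)) (hσ : ∀ q k, |σ q k| ≤ k₀)
    (hsup : ∀ (m : Fin N₀) (s : Fin 3 → ℤ), (∀ k, |s k| ≤ k₀) → ∃ q, μ q = m ∧ σ q = s)
    {cidx : Fin N₀ → Fin M} (hc : ∀ m, μ (cidx m) = m ∧ σ (cidx m) = 0)
    {w ω : ℝ → ℝ} {A R Wsup : ℝ} (hR0 : 0 ≤ R) (hW : ∀ r, R ≤ r → effPot w ω A r = 0) (hRϱ : R ≤ ϱ)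
    (hWle : ∀ r, (7 : ℝ) / 10 ≤ r → effPot w ω A r ≤ Wsup) (hWsup : 0 ≤ Wsup)
    {η₀ η₁ D : ℝ} (hD : 13 / 10 * D + 1 ≤ ϱ) (hη₀ : η₀ ≤ 3 / 10)
    (hgood : ∀ m, GoodAtScale η₁ D (superMotif x a μ σ) (cidx m)) (hbad : ∀ m, ¬ MaybeGoodAt η₀ D (superMotif x a μ σ) (cidx m))
    {eUp κT δ : ℝ} (hδ : 0 < δ)
    (hdef : ∑ m, (((∑ q, effPot w ω A (dist (x m) (superMotif x a μ σ q))) - effPot w ω A 0) / 2 - A) ≤ N₀ * (eUp - δ))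
    (CT : ℝ) : ¬ SchurTopologicalPricing η₀ η₁ w ω A eUp κT CT := fun h =>
  not_pairLevelLaw_of_cell hN₀ hsep hdual hb hdiam hk₀ hμσ hσ hsup hc hR0 hW hRϱ hWle hWsup hD hη₀ hgood hbad hδ hdef
    (c₁ := -CT) (by ring) (pairLevelLaw_of_schurTopologicalPricing h)

/-- **FRG♭ dies** on such a cell when the mean priced site energy is below `e₁` by `δ` (for every `C`; any `η₁`-flag data, e.g. `η₁ = η₀`'s
complement is not needed: take `η₁` with all classes capped-good). [folklore] -/
theorem not_schurRangeGap_of_cell {N₀ M k₀ : ℕ} {x : Fin N₀ → E3} {a b : Fin 3 → E3} {cB ϱ diam : ℝ} (hN₀ : 1 ≤ N₀)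
    (hsep : PerSep x a) (hdual : ∀ j k, inner ℝ (b j) (a k) = if j = k then (1 : ℝ) else 0) (hb : ∀ j, ‖b j‖ ≤ cB)
    (hdiam : DiamLE x diam) (hk₀ : cB * (ϱ + diam) < k₀ + 1)
    {μ : Fin M → Fin N₀} {σ : Fin M → Fin 3 → ℤ} (hμσ : Function.Injective fun q => (μ q, σ q)) (hσ : ∀ q k, |σ q k| ≤ k₀)
    (hsup : ∀ (m : Fin N₀) (s : Fin 3 → ℤ), (∀ k, |s k| ≤ k₀) → ∃ q, μ q = m ∧ σ q = s)
    {cidx : Fin N₀ → Fin M} (hc : ∀ m, μ (cidx m) = m ∧ σ (cidx m) = 0)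
    {w ω : ℝ → ℝ} {A R Wsup : ℝ} (hR0 : 0 ≤ R) (hW : ∀ r, R ≤ r → effPot w ω A r = 0) (hRϱ : R ≤ ϱ)
    (hWle : ∀ r, (7 : ℝ) / 10 ≤ r → effPot w ω A r ≤ Wsup) (hWsup : 0 ≤ Wsup)
    {η₁ D : ℝ} (hD : 13 / 10 * D + 1 ≤ ϱ)
    (hgood : ∀ m, GoodAtScale η₁ D (superMotif x a μ σ) (cidx m)) (hbad : ∀ m, ¬ MaybeGoodAt (1 / 20) D (superMotif x a μ σ) (cidx m))
    {e₁ δ : ℝ} (hδ : 0 < δ)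
    (hdef : ∑ m, (((∑ q, effPot w ω A (dist (x m) (superMotif x a μ σ q))) - effPot w ω A 0) / 2 - A) ≤ N₀ * (e₁ - δ))
    (C : ℝ) : ¬ SchurRangeGap w ω A e₁ C := fun h =>
  not_pairLevelLaw_of_cell hN₀ hsep hdual hb hdiam hk₀ hμσ hσ hsup hc hR0 hW hRϱ hWle hWsup hD (by norm_num) hgood hbad hδ
    (by simpa using hdef) (c₁ := -C) (c₂ := 0) (by ring) (pairLevelLaw_of_schurRangeGap η₁ h)

end Summit.AtomisticToContinuum.Crystallization.Theorems.FrustratedLawDichotomyPeriodicBlockViolation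

end
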